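import Summits.ValiantsHypothesis.ValiantsHypothesis.Theorems.SymPencilEquivariantSdcNotQPPermEmbeddingOfIrreducible
import Summits.ValiantsHypothesis.ValiantsHypothesis.Theorems.SymPencilEquivariantSdcNotQPPermEmbeddingOfYoungBoundsPrelim
import Summits.ValiantsHypothesis.ValiantsHypothesis.Theorems.SymPencilEquivariantSdcNotQPPermifyOfPermEmbedding
import HarnessLib

/-!
# ValiantsHypothesis / SymPencil — crux `EquivariantSdcNotQP` (stmt-ValiantsHypothesis-17792), line
# `birth_EquivariantSdcNotQP`, stub `stub_permify`: the residue (D) REDUCED TO TWO CLASSICAL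
# STATEMENTS ABOUT THE ALTERNATING GROUPS

State of the line before this file (kernel-checked chain, all helpers of the item):
`stub_permify` ⇐ (iii′) `PermEmbeddingQP` [`permify_of_permEmbedding`] ⇐ (iii″) [`permEmbeddingQP_of_abstract`]
⇐ (D) [`permEmbedding_of_irreducible`], where (D) — hypothesis `hD` of `permEmbedding_of_irreducible`,
verbatim below — says: every IRREDUCIBLE representation `ρ : G →* GL_k(ℂ)` of a finite group `G` with a
surjection `φ : G ↠ 𝔖_n × 𝔖_n`, scalar with `M`-th roots of unity on `ker φ`, `k ≤ M`, is an
equivariant retract of a permutation representation of size `≤ 2^{(log₂ M + log₂ n + d)^d}`.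

This file (helper of the item, `--supports stmt-ValiantsHypothesis-17792 --as helper`; 0 definitions,
0 named facts, nothing tagged as a Literature fact) proves **(H1) → (H2) → (D)**
(`permEmbeddingD_of_alternatingBounds`), hence **(H1) → (H2) → (iii′)** and
**(H1) → (H2) → the conclusion of `stub_permify`** (`permEmbeddingQP_of_alternatingBounds`,
`permify_of_alternatingBounds`), where (H1), (H2) are the following two statements of the classical
representation theory of the alternating groups, assumed as HYPOTHESES (theorem binders), both stated
for the index-`4` level `𝔄_n × 𝔄_n` (where the mixed `sgn ⊗ sgn` Schur class of `𝔖_n × 𝔖_n`, which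
has irreducible projective representations of dimension `2`, dies) and in the irreducibility-free
form (equivalent to the form for irreducible representations by Maschke's theorem and passage to an
irreducible constituent):

* **(H1) spin dichotomy.**  `∃ a, ∀ n k`, for every finite group `E` with a surjection
  `ψ : E ↠ 𝔄_n × 𝔄_n` and every representation `σ : E →* GL_k(ℂ)` that is scalar on `ker ψ`:
  either `n ≤ a (log₂ k + 1)`, or the central character extends to a linear character
  `θ : E →* ℂˣ` (`σ(g) = θ(g)·1` on `ker ψ`).  In print: after dividing by `ker σ ∩ ker ψ` the
  extension is central; the obstruction to extending the central character is its Schur class in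
  `H²(𝔄_n × 𝔄_n, ℂˣ) = M(𝔄_n)² = (ℤ/2)²` for `n ≥ 8` (Schur 1911, [Hoffman–Humphreys, *Projective
  representations of the symmetric groups*, Thm. 2.11]: `M(𝔄_n) = ℤ/2` for `n ≥ 8`; the
  Schur–Künneth formula `M(G₁ × G₂) = M(G₁) × M(G₂) × (G₁^{ab} ⊗ G₂^{ab})` for the perfect group
  `𝔄_n`, [Karpilovsky, *The Schur multiplier*, §2]); a non-trivial class restricts non-trivially to
  one factor `𝔄_n`, whose irreducible constituents are then spin representations of `2·𝔄_n`, of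
  degree `≥ ½ · 2^{⌊(n - ℓ(λ) - 1)/2⌋}` with `ℓ(λ) ≤ √(2n)` the length of a strict partition of `n`
  ([Hoffman–Humphreys, Thm. 10.7], Schur 1911; Wagner 1977); `a = 8` suffices (`n ≤ 7` is absorbed by
  the constant).
* **(H2) Young fixed vectors.**  `∃ c, ∀ n k`, every representation `σ : 𝔄_n × 𝔄_n →* GL_k(ℂ)`,
  `k ≥ 1`, has a nonzero linear functional fixed by a subgroup of index
  `≤ 2^{(log₂ k + log₂ n + c)^c}`.  In print: irreducible representations of a direct product are
  outer tensor products; an irreducible `𝔄_n`-module is a constituent of some `[λ]↓𝔄_n`; Young's rule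
  `([λ], 1↑_{𝔖_λ}^{𝔖_n}) = 1` [James–Kerber 2.3.15 (ii), 2.8.5] gives a vector fixed by the Young
  subgroup `𝔖_λ ∩ 𝔄_n` (index `≤ 2 · n!/λ!`, and `[λ]↓𝔄_n ≅ [λ']↓𝔄_n` lets one choose the
  orientation with `λ₁ ≥ λ'₁`); the degree estimates from the hook formula [James–Kerber 2.3.21]
  (`f^λ ≥ binom(n-t, t)` for `t = n - λ₁`, monotonicity of `f` under containment of diagrams,
  Rasala 1977) bound `t log₂ n` quasi-polynomially in `log₂ f^λ + log₂ n`.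

Proof of the reduction (all tools landed on this line): `k = 0` is trivial; if `n ≤ 4` or (H1) gives
`n ≤ a (log₂ k + 1)`, the Frobenius retract through `L = ker ρ` (`permRetract_frobenius`) has size
`[G : ker ρ] ≤ |𝔖_n × 𝔖_n| · M ≤ 2^{(log₂ M + log₂ n + 2a+3)^{2a+3}}` (`index_ker_le_card_mul`,
`budget_large`); otherwise (H1) gives `θ` on `G₀ = φ⁻¹(𝔄_n × 𝔄_n)`, the twisted representation
`θ⁻¹ ρ|_{G₀}` is trivial on `ker ψ` and descends to `𝔄_n × 𝔄_n` (`MonoidHom.liftOfRightInverse`), (H2)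
gives `Y` and `ℓ`, and `ℓ` is fixed by `L = Y.comap ψ ⊓ ker θ ≤ G₀ ≤ G`, of index
`≤ 4 · 2^{(log₂ k + log₂ n + c)^c} · [G₀ : ker θ]` with `[G₀ : ker θ] ≤ M` because `𝔄_n × 𝔄_n` is
PERFECT for `n ≥ 5` (`commutator_alternatingGroup_eq_top`, `Subgroup.commutator_prod_prod`), so
`ker θ ⊔ ker ψ = G₀` and `θ(G₀) = θ(ker ψ) ⊆ μ_M`; then `permRetract_frobenius` again (`budget_small`).

So after this file the registered residue (D) of `stub_permify` is implied by the two NAMED classical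
statements (H1), (H2) (representation theory of `𝔄_n` and its double cover; not in Mathlib).
Honest framing: a CONDITIONAL reduction on a conditional route; (H1), (H2) are assumed, not proved;
`stub_permify`, the crux `SymPencil.EquivariantSdcNotQP` and `VP ≠ VNP` remain OPEN and nothing here
is progress on them.
-/

noncomputable section

set_option linter.dupNamespace false

namespace Summit.ValiantsHypothesis.ValiantsHypothesis.Theorems.SymPencilEquivariantSdcNotQP

open Matrix

/-! ## The reduction -/

open YoungBounds in
/-- **(D) ⇐ (H1) ∧ (H2): the residue of `stub_permify` reduced to two classical statements about the
alternating groups.**  Assume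
(H1) *spin dichotomy* — a complex representation of a finite group over `𝔄_n × 𝔄_n`, scalar on the
kernel, either has dimension `k` with `n ≤ a (log₂ k + 1)` or has its central character extend to a
linear character of the group (Schur multiplier `M(𝔄_n) = ℤ/2`, Hoffman–Humphreys Thm. 2.11, and the
degrees of the spin representations, Hoffman–Humphreys Thm. 10.7; Schur 1911) — and
(H2) *Young fixed vectors* — every complex representation of `𝔄_n × 𝔄_n` of dimension `k ≥ 1` has a
nonzero functional fixed by a subgroup of index `≤ 2^{(log₂ k + log₂ n + c)^c}` (Young's rule,
James–Kerber 2.3.15 (ii) / 2.8.5, with the hook-formula degree estimates, James–Kerber 2.3.21,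
Rasala 1977).  Then (D), the hypothesis `hD` of `permEmbedding_of_irreducible` (verbatim), holds:
through `ker ρ` when `n` is small against `log₂ k` (`permRetract_frobenius`, `index_ker_le_card_mul`),
and otherwise through `Y.comap ψ ⊓ ker θ` for the twisted representation `θ⁻¹ρ` on
`φ⁻¹(𝔄_n × 𝔄_n)`, perfectness of `𝔄_n × 𝔄_n` (`n ≥ 5`) bounding `[φ⁻¹(𝔄_n × 𝔄_n) : ker θ] ≤ M`.
Conditional reduction; (H1), (H2), `stub_permify`, the crux and `VP ≠ VNP` remain OPEN. [folklore] -/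
theorem permEmbeddingD_of_alternatingBounds
    (hExt : ∃ a : ℕ, ∀ (n k : ℕ) (E : Type) [Group E] [Finite E]
      (ψ : E →* ↥(alternatingGroup (Fin n)) × ↥(alternatingGroup (Fin n)))
      (σ : E →* GL (Fin k) ℂ),
      Function.Surjective ψ →
      (∀ g : E, ψ g = 1 → ∃ c : ℂ,
        (σ g : Matrix (Fin k) (Fin k) ℂ) = c • (1 : Matrix (Fin k) (Fin k) ℂ)) →
      n ≤ a * (Nat.log 2 k + 1) ∨
        ∃ θ : E →* ℂˣ, ∀ g : E, ψ g = 1 →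
          (σ g : Matrix (Fin k) (Fin k) ℂ) = ((θ g : ℂˣ) : ℂ) • (1 : Matrix (Fin k) (Fin k) ℂ))
    (hYoung : ∃ c : ℕ, ∀ (n k : ℕ)
      (σ : ↥(alternatingGroup (Fin n)) × ↥(alternatingGroup (Fin n)) →* GL (Fin k) ℂ), 1 ≤ k →
      ∃ Y : Subgroup (↥(alternatingGroup (Fin n)) × ↥(alternatingGroup (Fin n))),
        Y.index ≤ 2 ^ ((Nat.log 2 k + Nat.log 2 n + c) ^ c) ∧
        ∃ ℓ : (Fin k → ℂ) →ₗ[ℂ] ℂ, ℓ ≠ 0 ∧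
          ∀ y ∈ Y, ℓ ∘ₗ Matrix.toLin' (σ y : Matrix (Fin k) (Fin k) ℂ) = ℓ) :
    ∃ d : ℕ, ∀ (n M k : ℕ) (G : Type) [Group G] [Finite G]
      (φ : G →* Equiv.Perm (Fin n) × Equiv.Perm (Fin n)) (ρ : G →* GL (Fin k) ℂ),
      Function.Surjective φ →
      (∀ g : G, φ g = 1 → ∃ c : ℂ, c ^ M = 1 ∧
        (ρ g : Matrix (Fin k) (Fin k) ℂ) = c • (1 : Matrix (Fin k) (Fin k) ℂ)) →
      k ≤ M →
      (∀ W : Submodule ℂ (Fin k → ℂ),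
        (∀ g : G, W ≤ W.comap (Matrix.toLin' (ρ g : Matrix (Fin k) (Fin k) ℂ))) → W = ⊥ ∨ W = ⊤) →
      ∃ m' ≤ 2 ^ ((Nat.log 2 M + Nat.log 2 n + d) ^ d),
        ∃ (ι : Matrix (Fin m') (Fin k) ℂ) (p : Matrix (Fin k) (Fin m') ℂ) (τ : G → Equiv.Perm (Fin m')),
          p * ι = 1 ∧ ∀ g : G,
            (τ g).permMatrix ℂ * ι = ι * (ρ g : Matrix (Fin k) (Fin k) ℂ) ∧
            p * (τ g).permMatrix ℂ = (ρ g : Matrix (Fin k) (Fin k) ℂ) * p := by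
  classical
  obtain ⟨a, ha⟩ := hExt
  obtain ⟨c, hc⟩ := hYoung
  set a' : ℕ := max a 4 with ha'
  set d : ℕ := max (2 * a' + 3) (c + 3) with hd
  refine ⟨d, fun n M k G _ _ φ ρ hφ hker hkM hirr => ?_⟩
  set Bd : ℕ := 2 ^ ((Nat.log 2 M + Nat.log 2 n + d) ^ d) with hBd
  -- `k = 0`: everything is a `Fin 0`-indexed matrix
  rcases Nat.eq_zero_or_pos k with hk0 | hk
  · subst hk0
    refine ⟨0, Nat.zero_le _, 0, 0, fun _ => 1, ?_, fun g => ⟨?_, ?_⟩⟩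
    · ext i; exact Fin.elim0 i
    · ext i; exact Fin.elim0 i
    · ext i; exact Fin.elim0 i
  have hM : M ≠ 0 := by omega
  -- common end of both regimes: a subgroup fixing a nonzero functional, of index within budget
  have finish : ∀ (L : Subgroup G) (ℓ : (Fin k → ℂ) →ₗ[ℂ] ℂ), ℓ ≠ 0 →
      (∀ l ∈ L, ℓ ∘ₗ Matrix.toLin' (ρ l : Matrix (Fin k) (Fin k) ℂ) = ℓ) → L.index ≤ Bd →
      ∃ m' ≤ Bd,
        ∃ (ι : Matrix (Fin m') (Fin k) ℂ) (p : Matrix (Fin k) (Fin m') ℂ) (τ : G → Equiv.Perm (Fin m')),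
          p * ι = 1 ∧ ∀ g : G,
            (τ g).permMatrix ℂ * ι = ι * (ρ g : Matrix (Fin k) (Fin k) ℂ) ∧
            p * (τ g).permMatrix ℂ = (ρ g : Matrix (Fin k) (Fin k) ℂ) * p := by
    intro L ℓ hℓ0 hℓL hidx
    obtain ⟨m', ι, p, τ, hm', hpι, hrel⟩ := permRetract_frobenius G L k ρ ℓ hirr hℓ0 hℓL
    exact ⟨m', hm' ▸ hidx, ι, p, τ, hpι, hrel⟩
  -- the large regime: Frobenius retract through `ker ρ`
  have large : n ≤ a' * (Nat.log 2 k + 1) →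
      ∃ m' ≤ Bd,
        ∃ (ι : Matrix (Fin m') (Fin k) ℂ) (p : Matrix (Fin k) (Fin m') ℂ) (τ : G → Equiv.Perm (Fin m')),
          p * ι = 1 ∧ ∀ g : G,
            (τ g).permMatrix ℂ * ι = ι * (ρ g : Matrix (Fin k) (Fin k) ℂ) ∧
            p * (τ g).permMatrix ℂ = (ρ g : Matrix (Fin k) (Fin k) ℂ) * p := by
    intro hn
    set i₀ : Fin k := ⟨0, hk⟩ with hi₀
    refine finish ρ.ker (LinearMap.proj i₀) ?_ ?_ ?_
    · intro h
      have := LinearMap.congr_fun h (Pi.single i₀ (1 : ℂ))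
      simp at this
    · intro l hl
      rw [MonoidHom.mem_ker] at hl
      rw [hl, Units.val_one, Matrix.toLin'_one, LinearMap.comp_id]
    · have hn' : n ≤ a' * (Nat.log 2 M + 1) :=
        hn.trans (Nat.mul_le_mul_left _ (Nat.succ_le_succ (Nat.log_mono_right hkM)))
      calc ρ.ker.index ≤ Nat.card (Equiv.Perm (Fin n) × Equiv.Perm (Fin n)) * M :=
            index_ker_le_card_mul hk M hM φ ρ hker
        _ ≤ 2 ^ ((Nat.log 2 M + Nat.log 2 n + (2 * a' + 3)) ^ (2 * a' + 3)) :=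
            budget_large a' n M hn'
        _ ≤ Bd := budget_mono _ _ _ _ (le_max_left _ _) (by omega)
  -- tiny `n`: large regime
  by_cases hn4 : n ≤ 4
  · refine large (hn4.trans ?_)
    calc 4 ≤ a' := le_max_right _ _
      _ ≤ a' * (Nat.log 2 k + 1) := Nat.le_mul_of_pos_right _ (Nat.succ_pos _)
  have hn5 : 5 ≤ n := by omega
  -- the index-`≤ 4` subgroup `G₀ = φ⁻¹(𝔄_n × 𝔄_n)` and `ψ : G₀ ↠ 𝔄_n × 𝔄_n`
  set AA : Subgroup (Equiv.Perm (Fin n) × Equiv.Perm (Fin n)) :=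
    (alternatingGroup (Fin n)).prod (alternatingGroup (Fin n)) with hAA
  set G₀ : Subgroup G := AA.comap φ with hG₀
  have hG₀idx : G₀.index ≤ 4 := by
    rw [hG₀, Subgroup.index_comap_of_surjective _ hφ]
    exact index_alternating_prod_le n
  let ψ₀ : G₀ →* AA := (φ.comp G₀.subtype).codRestrict AA (fun g => g.2)
  let ψ : G₀ →* ↥(alternatingGroup (Fin n)) × ↥(alternatingGroup (Fin n)) :=
    (Subgroup.prodEquiv (alternatingGroup (Fin n)) (alternatingGroup (Fin n))).toMonoidHom.comp ψ₀
  have hψ_surj : Function.Surjective ψ := by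
    intro x
    obtain ⟨y, hy⟩ :=
      (Subgroup.prodEquiv (alternatingGroup (Fin n)) (alternatingGroup (Fin n))).surjective x
    obtain ⟨g, hg⟩ := hφ (y : Equiv.Perm (Fin n) × Equiv.Perm (Fin n))
    have hgmem : g ∈ G₀ := by rw [hG₀, Subgroup.mem_comap, hg]; exact y.2
    refine ⟨⟨g, hgmem⟩, ?_⟩
    rw [← hy]
    change (Subgroup.prodEquiv _ _) (ψ₀ ⟨g, hgmem⟩) = _
    congr 1
    apply Subtype.ext
    change φ g = y
    exact hg
  have hψ_ker : ∀ g : G₀, ψ g = 1 ↔ φ (g : G) = 1 := by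
    intro g
    change (Subgroup.prodEquiv _ _) (ψ₀ g) = 1 ↔ _
    rw [MulEquiv.map_eq_one_iff, ← OneMemClass.coe_eq_one]
    exact Iff.rfl
  -- the restricted representation and (H1)
  let σ : G₀ →* GL (Fin k) ℂ := ρ.comp G₀.subtype
  have hσ : ∀ g : G₀, σ g = ρ (g : G) := fun g => rfl
  have hσker : ∀ g : G₀, ψ g = 1 → ∃ c : ℂ,
      (σ g : Matrix (Fin k) (Fin k) ℂ) = c • (1 : Matrix (Fin k) (Fin k) ℂ) := by
    intro g hg
    obtain ⟨c', -, hc'⟩ := hker g ((hψ_ker g).mp hg)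
    exact ⟨c', hc'⟩
  rcases ha n k G₀ ψ σ hψ_surj hσker with hsmall | ⟨θ, hθ⟩
  · exact large (hsmall.trans (Nat.mul_le_mul_right _ (le_max_left a 4)))
  -- `θ` has order dividing `M` on `ker ψ`, hence `[G₀ : ker θ] ≤ M` by perfectness
  have hθM : ∀ g : G₀, ψ g = 1 → θ g ^ M = 1 := by
    intro g hg
    obtain ⟨c', hc'M, hc'⟩ := hker g ((hψ_ker g).mp hg)
    have e : ((θ g : ℂˣ) : ℂ) = c' :=
      (scalar_eq_apply ⟨0, hk⟩ (hθ g hg)).trans (scalar_eq_apply ⟨0, hk⟩ hc').symm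
    apply Units.ext
    rw [Units.val_pow_eq_pow_val, e, hc'M, Units.val_one]
  have hθidx : θ.ker.index ≤ M :=
    index_ker_le_of_sup_eq_top ψ θ
      (ker_sup_ker_eq_top_of_perfect (commutator_alternating_prod_eq_top n hn5) ψ hψ_surj θ) M hM hθM
  -- the twisted representation `σ' = θ⁻¹ σ`, trivial on `ker ψ`, and its descent to `𝔄_n × 𝔄_n`
  let σ' : G₀ →* GL (Fin k) ℂ :=
    { toFun := fun g => ⟨((θ g)⁻¹ : ℂˣ).val • (σ g : Matrix (Fin k) (Fin k) ℂ),
        (θ g : ℂˣ).val • ((σ g)⁻¹ : GL (Fin k) ℂ).val, by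
          rw [Matrix.smul_mul, Matrix.mul_smul, smul_smul, Units.mul_inv, Units.inv_mul, one_smul], by
          rw [Matrix.smul_mul, Matrix.mul_smul, smul_smul, Units.inv_mul, Units.mul_inv, one_smul]⟩
      map_one' := by
        apply Units.ext
        simp only [map_one, inv_one, Units.val_one, one_smul]
      map_mul' := fun x y => by
        apply Units.ext
        simp only [map_mul, mul_inv, Units.val_mul, Matrix.smul_mul, Matrix.mul_smul, smul_smul]
        rw [mul_comm] }
  have hσ' : ∀ g, (σ' g : Matrix (Fin k) (Fin k) ℂ) =
      ((θ g)⁻¹ : ℂˣ).val • (σ g : Matrix (Fin k) (Fin k) ℂ) := fun g => rfl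
  have hσ'ker : ψ.ker ≤ σ'.ker := by
    intro g hg
    rw [MonoidHom.mem_ker] at hg ⊢
    apply Units.ext
    rw [hσ', hθ g hg, smul_smul, Units.inv_mul, one_smul, Units.val_one]
  obtain ⟨σA, hσA⟩ : ∃ σA : (↥(alternatingGroup (Fin n)) × ↥(alternatingGroup (Fin n))) →* GL (Fin k) ℂ,
      ∀ g, σA (ψ g) = σ' g :=
    ⟨ψ.liftOfRightInverse (Function.surjInv hψ_surj) (Function.rightInverse_surjInv hψ_surj) ⟨σ', hσ'ker⟩,
      fun g => MonoidHom.liftOfRightInverse_comp_apply ψ (Function.surjInv hψ_surj)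
        (Function.rightInverse_surjInv hψ_surj) ⟨σ', hσ'ker⟩ g⟩
  -- (H2) for the descended representation
  obtain ⟨Y, hYidx, ℓ, hℓ0, hℓY⟩ := hc n k σA hk
  -- the subgroup `L = (Y.comap ψ ⊓ ker θ) ≤ G₀ ≤ G` fixes `ℓ`
  set L : Subgroup G := (Y.comap ψ ⊓ θ.ker).map G₀.subtype with hL
  refine finish L ℓ hℓ0 ?_ ?_
  · intro l hl
    obtain ⟨g, hg, rfl⟩ := Subgroup.mem_map.mp hl
    obtain ⟨hgY, hgθ⟩ := Subgroup.mem_inf.mp hg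
    rw [Subgroup.mem_comap] at hgY
    rw [MonoidHom.mem_ker] at hgθ
    have e : (ρ (G₀.subtype g) : Matrix (Fin k) (Fin k) ℂ) = (σA (ψ g) : Matrix (Fin k) (Fin k) ℂ) := by
      rw [hσA, hσ', hgθ, inv_one, Units.val_one, one_smul, hσ, Subgroup.coe_subtype]
    rw [e]
    exact hℓY _ hgY
  · have h1 : L.index = (Y.comap ψ ⊓ θ.ker).index * G₀.index := Subgroup.index_map_subtype _
    have h2 : (Y.comap ψ ⊓ θ.ker).index ≤ (Y.comap ψ).index * θ.ker.index := Subgroup.index_inf_le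
    have h3 : (Y.comap ψ).index = Y.index := Subgroup.index_comap_of_surjective _ hψ_surj
    calc L.index ≤ (Y.comap ψ).index * θ.ker.index * G₀.index := by
          rw [h1]; exact Nat.mul_le_mul_right _ h2
      _ ≤ 2 ^ ((Nat.log 2 k + Nat.log 2 n + c) ^ c) * M * 4 := by
          rw [h3]; exact Nat.mul_le_mul (Nat.mul_le_mul hYidx hθidx) hG₀idx
      _ = 4 * 2 ^ ((Nat.log 2 k + Nat.log 2 n + c) ^ c) * M := by ring
      _ ≤ 2 ^ ((Nat.log 2 M + Nat.log 2 n + (c + 3)) ^ (c + 3)) := budget_small c n k M hkM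
      _ ≤ Bd := budget_mono _ _ _ _ (le_max_right _ _) (by omega)


/-- **(iii′) `PermEmbeddingQP` ⇐ (H1) ∧ (H2)** — composition of `permEmbeddingD_of_alternatingBounds`
with `permEmbeddingQP_of_irreducible` ((iii′) ⇐ (iii″) ⇐ (D)); the conclusion is hypothesis `h₃` of
`permify_of_permEmbedding` verbatim.  Conditional; (H1), (H2) assumed. [folklore] -/
theorem permEmbeddingQP_of_alternatingBounds
    (hExt : ∃ a : ℕ, ∀ (n k : ℕ) (E : Type) [Group E] [Finite E]
      (ψ : E →* ↥(alternatingGroup (Fin n)) × ↥(alternatingGroup (Fin n)))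
      (σ : E →* GL (Fin k) ℂ),
      Function.Surjective ψ →
      (∀ g : E, ψ g = 1 → ∃ c : ℂ,
        (σ g : Matrix (Fin k) (Fin k) ℂ) = c • (1 : Matrix (Fin k) (Fin k) ℂ)) →
      n ≤ a * (Nat.log 2 k + 1) ∨
        ∃ θ : E →* ℂˣ, ∀ g : E, ψ g = 1 →
          (σ g : Matrix (Fin k) (Fin k) ℂ) = ((θ g : ℂˣ) : ℂ) • (1 : Matrix (Fin k) (Fin k) ℂ))
    (hYoung : ∃ c : ℕ, ∀ (n k : ℕ)
      (σ : ↥(alternatingGroup (Fin n)) × ↥(alternatingGroup (Fin n)) →* GL (Fin k) ℂ), 1 ≤ k →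
      ∃ Y : Subgroup (↥(alternatingGroup (Fin n)) × ↥(alternatingGroup (Fin n))),
        Y.index ≤ 2 ^ ((Nat.log 2 k + Nat.log 2 n + c) ^ c) ∧
        ∃ ℓ : (Fin k → ℂ) →ₗ[ℂ] ℂ, ℓ ≠ 0 ∧
          ∀ y ∈ Y, ℓ ∘ₗ Matrix.toLin' (σ y : Matrix (Fin k) (Fin k) ℂ) = ℓ) :
    ∃ d : ℕ, ∀ (n m₀ : ℕ)
      (F : Subgroup ((Equiv.Perm (Fin n) × Equiv.Perm (Fin n)) × GL (Fin m₀) ℂ)),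
      (∀ π ρ : Equiv.Perm (Fin n), ∃ g : GL (Fin m₀) ℂ, ((π, ρ), g) ∈ F) →
      (∀ g : GL (Fin m₀) ℂ, ((1 : Equiv.Perm (Fin n) × Equiv.Perm (Fin n)), g) ∈ F →
        ∃ c : ℂ, (g : Matrix (Fin m₀) (Fin m₀) ℂ) = c • (1 : Matrix (Fin m₀) (Fin m₀) ℂ)) →
      (∀ x ∈ F, Matrix.det (x.2 : Matrix (Fin m₀) (Fin m₀) ℂ) = 1) →
      ∃ m' ≤ 2 ^ ((Nat.log 2 m₀ + Nat.log 2 n + d) ^ d),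
        ∃ (ι : Matrix (Fin m') (Fin m₀) ℂ) (p : Matrix (Fin m₀) (Fin m') ℂ)
          (τ : (Equiv.Perm (Fin n) × Equiv.Perm (Fin n)) × GL (Fin m₀) ℂ → Equiv.Perm (Fin m')),
          p * ι = 1 ∧ ∀ x ∈ F,
            (τ x).permMatrix ℂ * ι = ι * (x.2 : Matrix (Fin m₀) (Fin m₀) ℂ) ∧
            p * (τ x).permMatrix ℂ = (x.2 : Matrix (Fin m₀) (Fin m₀) ℂ) * p :=
  permEmbeddingQP_of_irreducible (permEmbeddingD_of_alternatingBounds hExt hYoung)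

open MvPolynomial Literature.Computability.AlgebraicComplexity in
/-- **The conclusion of the registered stub `stub_permify` ⇐ (H1) ∧ (H2)** — composition with
`permify_of_permEmbedding` (steps (i), (ii′), (iv) of `stub_permify`, all landed).  So the line
`birth_EquivariantSdcNotQP` of crux 17792 rests, after this file, on the two classical statements
(H1) (Schur multiplier and spin degrees of `𝔄_n`) and (H2) (Young's rule with degree bounds for
`𝔄_n × 𝔄_n`) — named, assumed, not in Mathlib.  Conditional; `stub_permify`, the crux
`SymPencil.EquivariantSdcNotQP` and `VP ≠ VNP` remain OPEN. [folklore] -/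
theorem permify_of_alternatingBounds
    (hExt : ∃ a : ℕ, ∀ (n k : ℕ) (E : Type) [Group E] [Finite E]
      (ψ : E →* ↥(alternatingGroup (Fin n)) × ↥(alternatingGroup (Fin n)))
      (σ : E →* GL (Fin k) ℂ),
      Function.Surjective ψ →
      (∀ g : E, ψ g = 1 → ∃ c : ℂ,
        (σ g : Matrix (Fin k) (Fin k) ℂ) = c • (1 : Matrix (Fin k) (Fin k) ℂ)) →
      n ≤ a * (Nat.log 2 k + 1) ∨
        ∃ θ : E →* ℂˣ, ∀ g : E, ψ g = 1 →
          (σ g : Matrix (Fin k) (Fin k) ℂ) = ((θ g : ℂˣ) : ℂ) • (1 : Matrix (Fin k) (Fin k) ℂ))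
    (hYoung : ∃ c : ℕ, ∀ (n k : ℕ)
      (σ : ↥(alternatingGroup (Fin n)) × ↥(alternatingGroup (Fin n)) →* GL (Fin k) ℂ), 1 ≤ k →
      ∃ Y : Subgroup (↥(alternatingGroup (Fin n)) × ↥(alternatingGroup (Fin n))),
        Y.index ≤ 2 ^ ((Nat.log 2 k + Nat.log 2 n + c) ^ c) ∧
        ∃ ℓ : (Fin k → ℂ) →ₗ[ℂ] ℂ, ℓ ≠ 0 ∧
          ∀ y ∈ Y, ℓ ∘ₗ Matrix.toLin' (σ y : Matrix (Fin k) (Fin k) ℂ) = ℓ) :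
    ∃ d : ℕ, ∀ (n m : ℕ) (A : Matrix (Fin m) (Fin m) (MvPolynomial (Fin n × Fin n) ℂ)),
      A.IsSymm → IsEquivariantDetRepr (Subgroup.closure {γ : GL (Fin n × Fin n) ℂ |
        ∃ π ρ : Equiv.Perm (Fin n), (γ : Matrix (Fin n × Fin n) (Fin n × Fin n) ℂ) =
          Equiv.Perm.permMatrix ℂ (Equiv.prodCongr π ρ)}) (perPoly (Fin n) ℂ) A →
      ∃ m' ≤ 2 ^ ((Nat.log 2 m + d) ^ d),
        ∃ A' : Matrix (Fin m') (Fin m') (MvPolynomial (Fin n × Fin n) ℂ),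
          IsAffineDetRepr (perPoly (Fin n) ℂ) A' ∧
          ∀ π ρ : Equiv.Perm (Fin n), ∃ σ : Equiv.Perm (Fin m'),
            A'.map (MvPolynomial.rename fun ij : Fin n × Fin n => (π ij.1, ρ ij.2)) =
              (σ.permMatrix ℂ).map MvPolynomial.C * A' * ((σ.permMatrix ℂ)ᵀ).map MvPolynomial.C :=
  permify_of_permEmbedding (permEmbeddingQP_of_alternatingBounds hExt hYoung)

end Summit.ValiantsHypothesis.ValiantsHypothesis.Theorems.SymPencilEquivariantSdcNotQP

end
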